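import Summits.QuantumFields.BalabanUV.Beta.GAN24.WoodburyFibreGaugeBox

/-!
# Beta / GAN24 / WoodburyFibreLandauBox — THE END of census row V9 on Bałaban's Neumann boxes (`A = 0`, ALL SCALES):
`N`-uniform cube decay of the Landau-gauge scalar operator `flucCov (L_n·L_n + Qnᴴ(c·1)Qn) Qn` (block-constrained inverse
of the squared box Laplacian), plus the by-products: the hard fluctuation covariance `Γ_k(□)` and Bałaban's minimiser `H_k(□)`

Cell `pub-balaban`, β sub-cell, BINDER ROW **G-an2-4 ∕ (CONV-C)** («NOT IN PRINT; our proof attempt»), prover part **P3 =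
WOODBURY-FIBRE reduction** (lineage `b2b-balaban-gan24-p3`, gen 6).  HONEST FRAMING (verbatim): discharging `BetaPertH`
makes Bałaban's UV stability UNCONDITIONAL — a real constructive-QFT result; it is NOT the continuum limit and NOT the Clay
problem.  HONEST DEPENDENCY: continuum YM on T⁴ ⇐ BetaPertH ∧ nine spine estimates (0/9 proved); BetaPertH ⇐ (D1) ∧ (D4) ∧
CAP+tail; G-an2-4 gates asym, D1 and NE2/3/4.  `[folklore]` assembly over tree theorems; 0 sorry; nothing printed and nothing
programme-internal is used as a hypothesis.  What is proved concerns Bałaban's SCALAR box operators at `A = 0`; it is NOT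
(CONV-C), NOT `BetaPertH`, NOT «G-an2-4 closed».

## THE END (`landau_box_cubeDecay`)

For every dimension `d+1`, block size `L = ℓ+1 ≥ 2` and mass window `[0, m²₊]` there are `δ, C > 0` such that for EVERY scale
`k ≥ 1` (`n = L^k` fine points per unit length), every `m² ∈ [0, m²₊]`, every box `□ = Π_μ[0, M_μ)` of unit blocks (`M_μ ≥ 1`)
and every bi-regulariser weight `c > 0`:
  `Σ_{y : blk y = b′} |𝒮(x, y)| ≤ C·e^{−δ·|blk x − b′|_∞}`   for all fine `x` and unit `b′`,
`𝒮 = flucCov (L_n·L_n + Qnᴴ(c·1)Qn) Qn`, `L_n = boxOpR n 0 m² M = n²(−Δ^N_X) + m²`, `Qn = n^{−(d+1)/2}·indB` (`QnQnᴴ = 1`) — the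
inverse of the squared (massive) Neumann Laplacian constrained to zero block averages, i.e. the `A = 0`, box version of the
scalar operator of Bałaban's Landau-type block gauge [B5 (1.24)–(1.28) p. 22 «λ₀ = Δ⁻¹d*A − Δ⁻²Q′*(Q′Δ⁻²Q′*)⁻¹Q′Δ⁻¹d*A»;
tree locator `B5Infimum124.lambda0_min`; an2's `BiLaplaceBlockKKT.Sb` on ℤ^{d+1}] — by gen 5's R17 (`flucCov_sq_reg`) it is
`Γ·coproj ℋ̃·Γ` and does not depend on `c`.  The constants are the explicit functions `vRate`, `vConst` of the scalar data
`(K = latticeConst (d+1), γ_B = gammaQ (d+1) (m²₊ + 1), c₀, δ₀)`, `(δ₀, c₀)` from B4 (1.10); no numerical value is claimed.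
PRIMITIVE FORM (§4, `landau_box_cubeDecay_indB`): the same for `flucCov (L_n·L_n + c·SᵀS) S`, `S = indB n M` the 0∕1 block-incidence
matrix (Bałaban's `Q_k^* = Sᵀ`), any `c > 0` — `flucCov` does not see the normalisation of the constraint rows (`flucCov_smul_real`).

## Inputs, all BY NAME
R20 `GAN24/WoodburyFibreGaugeCubeDecay.cubeDecay_flucCov_sq` (gen 5) at `L := boxOpR n 0 m² M`, `Q := Qn`, `T := 1`,
`T₂ := c·1`; (i) `CubeDecay` of `G_k(□)` for all `k` — B4 (1.10) on boxes [Balaban1983RegularityDecay], tree theorem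
`B4Thm110ZeroBox.thm110_zero_box_roww_coeff` via `WoodburyFibreGaugeInputs.cubeDecay_boxGreen`; (ii) the `n`-uniform
coercivity of `Q_kG_k(□)Q_k^*` (`WoodburyFibreBoxQGQ.qGq_box_coercive`; B6 (2.76)'s box analogue); (iii) the derived decays
of `ℋ̃`, `Γ` and the invertibility of the bi-form (`WoodburyFibreGaugeBox`); (iv) `ℋ̃ᴴℋ̃ ⪰ (QnQnᴴ)⁻¹ = 1`.
By-products with the same uniformity (§3): `fluctuation_box_cubeDecay` (the hard fluctuation covariance
`Γ_k(□) = flucCov (boxOpR n a m² M) Qn`) and `minimiserHk_box_posDecay` (Bałaban's `H_k(□) = G Q_k^*(Q_kG_kQ_k^*)⁻¹` at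
`A = 0`: `|H_k(x, y)| ≤ C·e^{−δ|blk x − y|_∞}` — the B5 (1.103)-TYPE bound, boxes, all scales).
-/

namespace Summit.QuantumFields.BalabanUV.Beta.GAN24.WoodburyFibreLandauBox

open Finset Matrix
open Literature.MathematicalPhysics.QuantumFieldTheory.Balaban1983to89
open B4Reflection242 (boxDom)
open B4BoxCov237 (boxOpR indB rho rho_isPseudoDist boxOpR_isUnit)
open B4Sect5Torus (IsPseudoDist rate rate_pos rate_le_quarter)
open B4Sect5Proof (latticeConst)
open B5Decay126 (PosDecay PosProfile)
open B6QGQLower276 (gammaQ gammaQ_pos)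
open Summit.QuantumFields.BalabanUV.Beta.PropagatorWoodburyFibre (pivot minimiser flucCov)
open WoodburyFibreGaugeCubeDecay (CubeDecay ColCubeDecay cubeDecay_flucCov_sq)
open WoodburyFibreBoxQGQ (fineN blkBox qGq_box_coercive coercive_mono)
open WoodburyFibreGaugeInputs
open WoodburyFibreGaugeBox

noncomputable section

variable {d : ℕ}

/-! ## §1 The rate and the constant of THE END as functions of the scalar data -/

/-- the product `cH·cH′` of the two minimiser constants (it is `n`-free). [folklore] -/
def piH (K : ℝ → ℝ) (γ cG δ : ℝ) : ℝ := cG ^ 2 * (2 / γ) ^ 2 * K (rate K γ cG δ / 2) ^ 2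

/-- the common input rate `δ* = δP/4`. [folklore] -/
def dStar (K : ℝ → ℝ) (γ cG δ : ℝ) : ℝ := rate K γ cG δ / 4

/-- R20's capacitance rate `δ₁`. [folklore] -/
def dOne (K : ℝ → ℝ) (γ cG δ : ℝ) : ℝ :=
  rate K 1 (piH K γ cG δ * K (dStar K γ cG δ / 2)) (dStar K γ cG δ / 2)

/-- **the rate of THE END**, `δ₁/8`, as a function of the scalar data only. [folklore] -/
def vRate (K : ℝ → ℝ) (γ cG δ : ℝ) : ℝ := dOne K γ cG δ / 8

/-- **the constant of THE END**, as a function of the scalar data only. [folklore] -/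
def vConst (K : ℝ → ℝ) (γ cG δ : ℝ) : ℝ :=
  cGam K γ cG δ * cGam K γ cG δ * K (dStar K γ cG δ / 2)
    + 2 * piH K γ cG δ * (cGam K γ cG δ * cGam K γ cG δ) * K (dStar K γ cG δ / 2) * K (dOne K γ cG δ / 2)
      * K (dOne K γ cG δ / 4) * K (dOne K γ cG δ / 8)

/-- `0 < vRate`. [folklore] -/
theorem vRate_pos {K : ℝ → ℝ} (hK0 : ∀ t, 0 < t → 0 ≤ K t) {γ cG δ : ℝ} (hγ : 0 < γ) (hc : 0 ≤ cG) (hδ : 0 < δ) :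
    0 < vRate K γ cG δ := by
  have hP := rate_pos hK0 hγ hc hδ
  have hS : 0 < dStar K γ cG δ := by unfold dStar; positivity
  have h1 : 0 ≤ piH K γ cG δ * K (dStar K γ cG δ / 2) := by
    unfold piH; exact mul_nonneg (by positivity) (hK0 _ (by positivity))
  unfold vRate dOne
  exact div_pos (rate_pos hK0 one_pos h1 (by positivity)) (by norm_num)

/-- `0 < vConst` for the lattice profile `K = latticeConst (d+1)` (`K ≥ 1`) and `cG > 0`. [folklore] -/
theorem vConst_pos (d : ℕ) {γ cG δ : ℝ} (hγ : 0 < γ) (hc : 0 < cG) (hδ : 0 < δ) :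
    0 < vConst (latticeConst (d + 1)) γ cG δ := by
  have hK0 := latticeConst_nonneg' d
  have hP := rate_pos hK0 hγ hc.le hδ
  have hS : 0 < dStar (latticeConst (d + 1)) γ cG δ := by unfold dStar; positivity
  have hD : 0 < dOne (latticeConst (d + 1)) γ cG δ := by
    have := vRate_pos hK0 hγ hc.le hδ; unfold vRate at this; linarith
  have hΓ : 0 < cGam (latticeConst (d + 1)) γ cG δ := by
    unfold cGam
    have : 0 ≤ cG ^ 2 * (2 / γ) * latticeConst (d + 1) (rate (latticeConst (d + 1)) γ cG δ / 2)
        * latticeConst (d + 1) (rate (latticeConst (d + 1)) γ cG δ / 4) :=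
      mul_nonneg (mul_nonneg (by positivity) (hK0 _ (by positivity))) (hK0 _ (by positivity))
    linarith
  have hπ : 0 ≤ piH (latticeConst (d + 1)) γ cG δ := by unfold piH; positivity
  have hK1 : ∀ t : ℝ, 0 < t → 0 < latticeConst (d + 1) t :=
    fun t ht => lt_of_lt_of_le one_pos (B4Thm110ZeroBox.one_le_latticeConst d ht)
  unfold vConst
  have t1 : 0 < cGam (latticeConst (d + 1)) γ cG δ * cGam (latticeConst (d + 1)) γ cG δ
      * latticeConst (d + 1) (dStar (latticeConst (d + 1)) γ cG δ / 2) :=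
    mul_pos (mul_pos hΓ hΓ) (hK1 _ (by positivity))
  have t2 : 0 ≤ 2 * piH (latticeConst (d + 1)) γ cG δ
      * (cGam (latticeConst (d + 1)) γ cG δ * cGam (latticeConst (d + 1)) γ cG δ)
      * latticeConst (d + 1) (dStar (latticeConst (d + 1)) γ cG δ / 2)
      * latticeConst (d + 1) (dOne (latticeConst (d + 1)) γ cG δ / 2)
      * latticeConst (d + 1) (dOne (latticeConst (d + 1)) γ cG δ / 4)
      * latticeConst (d + 1) (dOne (latticeConst (d + 1)) γ cG δ / 8) := by
    refine mul_nonneg (mul_nonneg (mul_nonneg (mul_nonneg (mul_nonneg (by positivity) (by positivity))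
      (hK0 _ (by positivity))) (hK0 _ (by positivity))) (hK0 _ (by positivity))) (hK0 _ (by positivity))
  linarith

/-! ## §2 THE END on one box, from the scalar data -/

/-- **THE END on one box**: given cube decay `(cG, δ)` of `G = (boxOpR n 1 m² M)⁻¹` and coercivity `γ` of `Q_kG_kQ_k^*`,
the Landau-gauge scalar operator `flucCov (L·L + Qnᴴ(c·1)Qn) Qn` has `CubeDecay (vConst K γ cG δ) (vRate K γ cG δ)` —
R20 `cubeDecay_flucCov_sq` on the inputs of `WoodburyFibreGaugeBox`. [folklore] -/
theorem landau_box_of_data {n : ℕ} (hn : 1 ≤ n) (M : Fin (d + 1) → ℕ) (hM : ∀ i, 1 ≤ M i) {m2 : ℝ} (hm : 0 ≤ m2)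
    {cG δ γ : ℝ} (hδ : 0 < δ) (hγ : 0 < γ)
    (hG : CubeDecay (rho M) (blkBox hn M) id (boxOpR n 1 m2 M)⁻¹ cG δ)
    (hco : QGQInverse.Coercive ((((n : ℝ) ^ (d + 1))⁻¹) • (indB n M * (boxOpR n 1 m2 M)⁻¹ * (indB n M)ᵀ)) γ)
    {c : ℝ} (hc : 0 < c) :
    CubeDecay (rho M) (blkBox hn M) id
      (flucCov (boxOpR n 0 m2 M * boxOpR n 0 m2 M
        + (Qn n M)ᴴ * (c • (1 : Matrix ↥(boxDom M) ↥(boxDom M) ℝ)) * Qn n M) (Qn n M))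
      (vConst (latticeConst (d + 1)) γ cG δ) (vRate (latticeConst (d + 1)) γ cG δ) := by
  have hK0 := latticeConst_nonneg' d
  have hP := rate_pos hK0 hγ hG.1 hδ
  have hreg : boxOpR n 1 m2 M = boxOpR n 0 m2 M + (Qn n M)ᴴ * (1 : Matrix ↥(boxDom M) ↥(boxDom M) ℝ) * Qn n M := by
    rw [boxOpR_eq_reg M hn 1 m2, one_smul]
  have hΓ := cubeDecay_flucCov hn M hδ hγ hG hco
  have hH := PosDecay.mono (rho_isPseudoDist M).nonneg (posDecay_minimiser hn M hδ hγ hG hco)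
    (show rate (latticeConst (d + 1)) γ cG δ / 4 ≤ rate (latticeConst (d + 1)) γ cG δ / 2 by linarith)
  have hH' := ColCubeDecay.mono (rho_isPseudoDist M) (colCube_minimiser hn M hδ hγ hG hco)
    (show rate (latticeConst (d + 1)) γ cG δ / 4 ≤ rate (latticeConst (d + 1)) γ cG δ / 2 by linarith)
  rw [hreg] at hΓ hH hH'
  have hEnd := cubeDecay_flucCov_sq (rho_isPseudoDist M) hK0 (posProfile_rho M)
    (L := boxOpR n 0 m2 M) (Q := Qn n M) (T := (1 : Matrix ↥(boxDom M) ↥(boxDom M) ℝ))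
    (boxOpR_conjTranspose M 0 m2) Matrix.conjTranspose_one
    (by rw [← hreg]; exact boxOpR_isUnit hn one_pos hm hM)
    (by rw [← hreg, pivot_eq M hn]; exact QGQInverse.isUnit_of_coercive hγ hco)
    (isUnit_gram M hn) one_pos (gram_coercive_one M hn) (by positivity : 0 < rate (latticeConst (d + 1)) γ cG δ / 4)
    hΓ hH hH' (c • (1 : Matrix ↥(boxDom M) ↥(boxDom M) ℝ)) (isUnit_biForm hn M hM hm hc)
    (isUnit_pivot_biForm hn M hM hm hc)
  have key := sN_mul_sN_mul (d := d) hn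
  have hprod : sN d n * cG * (2 / γ) * latticeConst (d + 1) (rate (latticeConst (d + 1)) γ cG δ / 2)
      * (sN d n * ((n : ℝ) ^ (d + 1) * cG) * (2 / γ) * latticeConst (d + 1) (rate (latticeConst (d + 1)) γ cG δ / 2))
      = piH (latticeConst (d + 1)) γ cG δ := by
    unfold piH
    calc _ = (sN d n * sN d n * (n : ℝ) ^ (d + 1)) * (cG ^ 2 * (2 / γ) ^ 2
        * latticeConst (d + 1) (rate (latticeConst (d + 1)) γ cG δ / 2) ^ 2) := by ring
      _ = _ := by rw [key, one_mul]
  convert hEnd using 2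
  · simp only [vConst, dOne, dStar]; rw [← hprod]; ring
  · simp only [vRate, dOne, dStar]; rw [← hprod]

/-! ## §3 THE END for all scales, and the by-products -/

/-- the coercivity constant is antitone in the mass-plus-coupling parameter. [folklore] -/
theorem gammaQ_anti (D : ℕ) {a b : ℝ} (hb : 0 < 4 * (D : ℝ) + b) (hab : b ≤ a) : gammaQ D a ≤ gammaQ D b := by
  unfold gammaQ
  exact one_div_le_one_div_of_le (by positivity) (mul_le_mul_of_nonneg_left (by linarith) (by positivity))

/-- **THE END — the Landau-gauge scalar operator on Bałaban's Neumann boxes at `A = 0` decays in the cube currency UNIFORMLY IN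
THE SCALE**: see the module docstring.  Census row V9 of `HOME/b2b-balaban-gan24-p3/WOODBURY-FIBRE.md`, box version, CLOSED in
the kernel; NOT (CONV-C), NOT `BetaPertH`. [folklore] -/
theorem landau_box_cubeDecay (d ℓ : ℕ) (hℓ : 1 ≤ ℓ) {m2plus : ℝ} (hm2 : 0 ≤ m2plus) :
    ∃ δ C : ℝ, 0 < δ ∧ 0 < C ∧ ∀ (k : ℕ) (hk : 1 ≤ k) (m2 : ℝ), 0 ≤ m2 → m2 ≤ m2plus →
      ∀ (M : Fin (d + 1) → ℕ), (∀ i, 1 ≤ M i) → ∀ c : ℝ, 0 < c →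
        CubeDecay (rho M) (blkBox (Nat.one_le_pow k (ℓ + 1) (Nat.succ_pos ℓ)) M) id
          (flucCov (boxOpR ((ℓ + 1) ^ k) 0 m2 M * boxOpR ((ℓ + 1) ^ k) 0 m2 M
              + (Qn ((ℓ + 1) ^ k) M)ᴴ * (c • (1 : Matrix ↥(boxDom M) ↥(boxDom M) ℝ)) * Qn ((ℓ + 1) ^ k) M)
            (Qn ((ℓ + 1) ^ k) M)) C δ := by
  obtain ⟨δ₀, c₀, hδ₀, hc₀, hG⟩ := cubeDecay_boxGreen d ℓ hℓ 1 1 m2plus one_pos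
  have hγ : 0 < gammaQ (d + 1) (m2plus + 1) := gammaQ_pos _ (by linarith)
  refine ⟨vRate (latticeConst (d + 1)) (gammaQ (d + 1) (m2plus + 1)) c₀ δ₀,
    vConst (latticeConst (d + 1)) (gammaQ (d + 1) (m2plus + 1)) c₀ δ₀,
    vRate_pos (latticeConst_nonneg' d) hγ hc₀.le hδ₀, vConst_pos d hγ hc₀ hδ₀, fun k hk m2 h3 h4 M hM c hc => ?_⟩
  have hn : 1 ≤ (ℓ + 1) ^ k := Nat.one_le_pow k (ℓ + 1) (Nat.succ_pos ℓ)
  have h4D : 0 < 4 * ((d + 1 : ℕ) : ℝ) + (m2 + 1) := by positivity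
  have hco := coercive_mono (qGq_box_coercive (d := d) hn one_pos h3 hM)
    (gammaQ_anti (d + 1) h4D (by linarith : m2 + 1 ≤ m2plus + 1))
  exact landau_box_of_data hn M hM h3 hδ₀ hγ (hG k hk 1 m2 le_rfl le_rfl h3 h4 M hM) hco hc

/-- **BY-PRODUCT 1 — the hard fluctuation covariance `Γ_k(□) = flucCov (boxOpR n a m² M) Qn` (`= G − H_kQ_kG`,
normalisation-free) decays in the cube currency uniformly in the scale**, for `(a, m²)` in any window. [folklore] -/
theorem fluctuation_box_cubeDecay (d ℓ : ℕ) (hℓ : 1 ≤ ℓ) (amin aplus m2plus : ℝ) (ha : 0 < amin) (hap : amin ≤ aplus)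
    (hm2 : 0 ≤ m2plus) :
    ∃ δ C : ℝ, 0 < δ ∧ 0 < C ∧ ∀ (k : ℕ) (hk : 1 ≤ k) (a m2 : ℝ), amin ≤ a → a ≤ aplus → 0 ≤ m2 → m2 ≤ m2plus →
      ∀ (M : Fin (d + 1) → ℕ), (∀ i, 1 ≤ M i) →
        CubeDecay (rho M) (blkBox (Nat.one_le_pow k (ℓ + 1) (Nat.succ_pos ℓ)) M) id
          (flucCov (boxOpR ((ℓ + 1) ^ k) a m2 M) (Qn ((ℓ + 1) ^ k) M)) C δ := by
  obtain ⟨δ₀, c₀, hδ₀, hc₀, hG⟩ := cubeDecay_boxGreen d ℓ hℓ amin aplus m2plus ha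
  have hγ : 0 < gammaQ (d + 1) (m2plus + aplus) := gammaQ_pos _ (by linarith)
  have hK0 := latticeConst_nonneg' d
  have hP := rate_pos hK0 hγ hc₀.le hδ₀
  have hΓ : 0 < cGam (latticeConst (d + 1)) (gammaQ (d + 1) (m2plus + aplus)) c₀ δ₀ := by
    unfold cGam
    have : 0 ≤ c₀ ^ 2 * (2 / gammaQ (d + 1) (m2plus + aplus))
        * latticeConst (d + 1) (rate (latticeConst (d + 1)) (gammaQ (d + 1) (m2plus + aplus)) c₀ δ₀ / 2)
        * latticeConst (d + 1) (rate (latticeConst (d + 1)) (gammaQ (d + 1) (m2plus + aplus)) c₀ δ₀ / 4) :=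
      mul_nonneg (mul_nonneg (by positivity) (hK0 _ (by positivity))) (hK0 _ (by positivity))
    linarith
  refine ⟨rate (latticeConst (d + 1)) (gammaQ (d + 1) (m2plus + aplus)) c₀ δ₀ / 4,
    cGam (latticeConst (d + 1)) (gammaQ (d + 1) (m2plus + aplus)) c₀ δ₀, by positivity, hΓ,
    fun k hk a m2 h1 h2 h3 h4 M hM => ?_⟩
  have hn : 1 ≤ (ℓ + 1) ^ k := Nat.one_le_pow k (ℓ + 1) (Nat.succ_pos ℓ)
  have h4D : 0 < 4 * ((d + 1 : ℕ) : ℝ) + (m2 + a) := by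
    have : 0 < a := by linarith
    positivity
  have hco := coercive_mono (qGq_box_coercive (d := d) hn (by linarith) h3 hM)
    (gammaQ_anti (d + 1) h4D (by linarith : m2 + a ≤ m2plus + aplus))
  exact cubeDecay_flucCov hn M hδ₀ hγ (hG k hk a m2 h1 h2 h3 h4 M hM) hco

/-- **BY-PRODUCT 2 — BAŁABAN'S MINIMISER `H_k(□) = G Q_k^*(Q_kG_kQ_k^*)⁻¹` AT `A = 0` ON NEUMANN BOXES DECAYS UNIFORMLY IN
THE SCALE**: `|H_k(□)(x, y)| ≤ C·e^{−δ·|blk x − y|_∞}` with `(δ, C)` depending on `d, ℓ` and the window only — the B5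
(1.103)-TYPE statement («|H_k(x,y)| ≤ O(1)e^{−δ|x−y|}», there for tori and general `U`; here boxes, `U = 1`), obtained from
B4 (1.10) (tree) and the box coercivity by finite Combes–Thomas; nothing printed is a hypothesis.  In matrix form
`H_k(□) = G·Sᵀ·(n^{−(d+1)}·S·G·Sᵀ)⁻¹`, `G = (boxOpR n a m² M)⁻¹`, `S = indB n M`. [folklore] -/
theorem minimiserHk_box_posDecay (d ℓ : ℕ) (hℓ : 1 ≤ ℓ) (amin aplus m2plus : ℝ) (ha : 0 < amin) (hap : amin ≤ aplus)
    (hm2 : 0 ≤ m2plus) :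
    ∃ δ C : ℝ, 0 < δ ∧ 0 < C ∧ ∀ (k : ℕ) (hk : 1 ≤ k) (a m2 : ℝ), amin ≤ a → a ≤ aplus → 0 ≤ m2 → m2 ≤ m2plus →
      ∀ (M : Fin (d + 1) → ℕ), (∀ i, 1 ≤ M i) →
        PosDecay (rho M) (id ∘ blkBox (Nat.one_le_pow k (ℓ + 1) (Nat.succ_pos ℓ)) M) id
          ((boxOpR ((ℓ + 1) ^ k) a m2 M)⁻¹ * (indB ((ℓ + 1) ^ k) M)ᵀ
            * (((((ℓ + 1) ^ k : ℕ) : ℝ) ^ (d + 1))⁻¹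
              • (indB ((ℓ + 1) ^ k) M * (boxOpR ((ℓ + 1) ^ k) a m2 M)⁻¹ * (indB ((ℓ + 1) ^ k) M)ᵀ))⁻¹) C δ := by
  obtain ⟨δ₀, c₀, hδ₀, hc₀, hG⟩ := cubeDecay_boxGreen d ℓ hℓ amin aplus m2plus ha
  have hγ : 0 < gammaQ (d + 1) (m2plus + aplus) := gammaQ_pos _ (by linarith)
  have hK0 := latticeConst_nonneg' d
  have hP := rate_pos hK0 hγ hc₀.le hδ₀
  have hK1 : ∀ t : ℝ, 0 < t → 0 < latticeConst (d + 1) t :=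
    fun t ht => lt_of_lt_of_le one_pos (B4Thm110ZeroBox.one_le_latticeConst d ht)
  refine ⟨rate (latticeConst (d + 1)) (gammaQ (d + 1) (m2plus + aplus)) c₀ δ₀ / 2,
    c₀ * (2 / gammaQ (d + 1) (m2plus + aplus))
      * latticeConst (d + 1) (rate (latticeConst (d + 1)) (gammaQ (d + 1) (m2plus + aplus)) c₀ δ₀ / 2),
    by positivity, mul_pos (by positivity) (hK1 _ (by positivity)), fun k hk a m2 h1 h2 h3 h4 M hM => ?_⟩
  have hn : 1 ≤ (ℓ + 1) ^ k := Nat.one_le_pow k (ℓ + 1) (Nat.succ_pos ℓ)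
  have h4D : 0 < 4 * ((d + 1 : ℕ) : ℝ) + (m2 + a) := by
    have : 0 < a := by linarith
    positivity
  have hco := coercive_mono (qGq_box_coercive (d := d) hn (by linarith) h3 hM)
    (gammaQ_anti (d + 1) h4D (by linarith : m2 + a ≤ m2plus + aplus))
  have hGk := hG k hk a m2 h1 h2 h3 h4 M hM
  have hinv := posDecay_pivotQn_inv hn M hδ₀ hγ hGk hco
  rw [pivot_eq M hn] at hinv
  have h4 : rate (latticeConst (d + 1)) (gammaQ (d + 1) (m2plus + aplus)) c₀ δ₀ ≤ δ₀ / 4 := rate_le_quarter _ _ _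
  exact PosDecay.mul (rho_isPseudoDist M) hK0 (posProfile_rho M) (posDecay_G_indBT hn M hGk) hinv (by positivity)
    (by positivity) (by linarith) (by linarith)

/-! ## §4 THE END in the primitive objects: the 0∕1 block-incidence matrix `S = indB n M` (normalisation invariance) -/

/-- scaling the constraint rows rescales the minimiser: `minimiser H (t·Q) = t⁻¹·minimiser H Q` (`t ≠ 0`, real). [folklore] -/
theorem minimiser_smul_real {p q : Type*} [Fintype p] [Fintype q] [DecidableEq p] [DecidableEq q] (H : Matrix q q ℝ)
    (Q : Matrix p q ℝ) {t : ℝ} (ht : t ≠ 0) (hP : IsUnit (pivot H Q)) :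
    minimiser H (t • Q) = t⁻¹ • minimiser H Q := by
  have hPd : IsUnit (pivot H Q).det := (Matrix.isUnit_iff_isUnit_det _).1 hP
  have hpiv : pivot H (t • Q) = (t * t) • pivot H Q := by
    simp only [pivot, Matrix.conjTranspose_smul, star_trivial, Matrix.smul_mul, Matrix.mul_smul, smul_smul]
  have heff : PropagatorWoodburyFibre.effForm H (t • Q) = (t * t)⁻¹ • PropagatorWoodburyFibre.effForm H Q := by
    rw [PropagatorWoodburyFibre.effForm, hpiv]
    apply Matrix.inv_eq_left_inv
    rw [Matrix.smul_mul, Matrix.mul_smul, smul_smul, PropagatorWoodburyFibre.effForm, Matrix.nonsing_inv_mul _ hPd,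
      inv_mul_cancel₀ (mul_ne_zero ht ht), one_smul]
  rw [minimiser, minimiser, heff, Matrix.conjTranspose_smul, star_trivial]
  simp only [Matrix.smul_mul, Matrix.mul_smul, smul_smul]
  congr 1
  field_simp

/-- **the fluctuation covariance does not see the normalisation of the constraint rows**: `flucCov H (t·Q) = flucCov H Q`
(`t ≠ 0`). [folklore] -/
theorem flucCov_smul_real {p q : Type*} [Fintype p] [Fintype q] [DecidableEq p] [DecidableEq q] (H : Matrix q q ℝ)
    (Q : Matrix p q ℝ) {t : ℝ} (ht : t ≠ 0) (hP : IsUnit (pivot H Q)) : flucCov H (t • Q) = flucCov H Q := by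
  rw [flucCov_eq_sub, flucCov_eq_sub, minimiser_smul_real H Q ht hP]
  simp only [Matrix.smul_mul, Matrix.mul_smul, smul_smul, mul_inv_cancel₀ ht, one_smul]

/-- **THE END, PRIMITIVE FORM**: the same statement for `flucCov (L_n·L_n + c·SᵀS) S` with the 0∕1 block-incidence matrix
`S = indB n M` (Bałaban's `Q_k^* = Sᵀ`, `Q_k = n^{−(d+1)}S`) and ANY `c > 0` — the block-constrained inverse of the squared
Neumann Laplacian in the rawest matrix form; same `δ, C`. [folklore] -/
theorem landau_box_cubeDecay_indB (d ℓ : ℕ) (hℓ : 1 ≤ ℓ) {m2plus : ℝ} (hm2 : 0 ≤ m2plus) :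
    ∃ δ C : ℝ, 0 < δ ∧ 0 < C ∧ ∀ (k : ℕ) (hk : 1 ≤ k) (m2 : ℝ), 0 ≤ m2 → m2 ≤ m2plus →
      ∀ (M : Fin (d + 1) → ℕ), (∀ i, 1 ≤ M i) → ∀ c : ℝ, 0 < c →
        CubeDecay (rho M) (blkBox (Nat.one_le_pow k (ℓ + 1) (Nat.succ_pos ℓ)) M) id
          (flucCov (boxOpR ((ℓ + 1) ^ k) 0 m2 M * boxOpR ((ℓ + 1) ^ k) 0 m2 M
              + c • ((indB ((ℓ + 1) ^ k) M)ᵀ * indB ((ℓ + 1) ^ k) M)) (indB ((ℓ + 1) ^ k) M)) C δ := by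
  obtain ⟨δ, C, hδ, hC, h⟩ := landau_box_cubeDecay d ℓ hℓ hm2
  refine ⟨δ, C, hδ, hC, fun k hk m2 h3 h4 M hM c hc => ?_⟩
  have hn : 1 ≤ (ℓ + 1) ^ k := Nat.one_le_pow k (ℓ + 1) (Nat.succ_pos ℓ)
  have hn0 : (0 : ℝ) < (((ℓ + 1) ^ k : ℕ) : ℝ) := by exact_mod_cast hn
  have hN : (0 : ℝ) < (((ℓ + 1) ^ k : ℕ) : ℝ) ^ (d + 1) := by positivity
  have h' := h k hk m2 h3 h4 M hM (c * (((ℓ + 1) ^ k : ℕ) : ℝ) ^ (d + 1)) (by positivity)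
  have hreg : (Qn ((ℓ + 1) ^ k) M)ᴴ * ((c * (((ℓ + 1) ^ k : ℕ) : ℝ) ^ (d + 1)) • (1 : Matrix ↥(boxDom M) ↥(boxDom M) ℝ))
      * Qn ((ℓ + 1) ^ k) M = c • ((indB ((ℓ + 1) ^ k) M)ᵀ * indB ((ℓ + 1) ^ k) M) := by
    rw [reg_eq M hn]; congr 1; field_simp
  have hP : IsUnit (pivot (boxOpR ((ℓ + 1) ^ k) 0 m2 M * boxOpR ((ℓ + 1) ^ k) 0 m2 M
      + c • ((indB ((ℓ + 1) ^ k) M)ᵀ * indB ((ℓ + 1) ^ k) M)) (Qn ((ℓ + 1) ^ k) M)) := by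
    rw [← hreg]; exact isUnit_pivot_biForm hn M hM h3 (by positivity)
  have hQ : (sN d ((ℓ + 1) ^ k))⁻¹ • Qn ((ℓ + 1) ^ k) M = indB ((ℓ + 1) ^ k) M := by
    rw [Qn, smul_smul, inv_mul_cancel₀ (sN_pos hn).ne', one_smul]
  have e := flucCov_smul_real _ (Qn ((ℓ + 1) ^ k) M) (inv_ne_zero (sN_pos (d := d) hn).ne') hP
  rw [hQ] at e
  rw [hreg] at h'
  rw [e]
  exact h'

/-! ## §5 Non-vacuity: the physical case `d + 1 = 4`, `L = 2`, masses `m² ∈ [0, 1]` -/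

/-- THE END at `d + 1 = 4`, `L = 2`, `m² ∈ [0, 1]`: the hypotheses are met and the quantifier prefix is inhabited (`k = 1`,
`m² = 0`, the unit cube `M ≡ 1`, `c = 1`). -/
example : ∃ δ C : ℝ, 0 < δ ∧ 0 < C ∧ ∀ (k : ℕ) (hk : 1 ≤ k) (m2 : ℝ), 0 ≤ m2 → m2 ≤ 1 →
      ∀ (M : Fin (3 + 1) → ℕ), (∀ i, 1 ≤ M i) → ∀ c : ℝ, 0 < c →
        CubeDecay (rho M) (blkBox (Nat.one_le_pow k (1 + 1) (Nat.succ_pos 1)) M) id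
          (flucCov (boxOpR ((1 + 1) ^ k) 0 m2 M * boxOpR ((1 + 1) ^ k) 0 m2 M
              + (Qn ((1 + 1) ^ k) M)ᴴ * (c • (1 : Matrix ↥(boxDom M) ↥(boxDom M) ℝ)) * Qn ((1 + 1) ^ k) M)
            (Qn ((1 + 1) ^ k) M)) C δ :=
  landau_box_cubeDecay 3 1 le_rfl (m2plus := 1) (by norm_num)

/-- the quantifier prefix is inhabited. -/
example : (1 : ℕ) ≤ 1 ∧ (0 : ℝ) ≤ 0 ∧ (0 : ℝ) ≤ 1 ∧ (∀ i : Fin (3 + 1), 1 ≤ (fun _ => 1 : Fin (3 + 1) → ℕ) i) ∧ (0 : ℝ) < 1 :=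
  ⟨le_rfl, le_rfl, by norm_num, fun _ => le_rfl, one_pos⟩

end

end Summit.QuantumFields.BalabanUV.Beta.GAN24.WoodburyFibreLandauBox
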